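import Mathlib
import HarnessLib
import Summits.ResolutionOfSingularities.ResolutionOfSingularities.Theorems.WildQuotientsWildQuotientResolutionS1aTparabChartMember
import Summits.ResolutionOfSingularities.ResolutionOfSingularities.Theorems.WildQuotientsWildQuotientResolutionS1aLinesKillsIn
import Summits.ResolutionOfSingularities.ResolutionOfSingularities.Theorems.WildQuotientsWildQuotientResolutionS1aLinShear

/-!
# S1a — R4a ★ `tparab_killsIn_two`: the TANGENT-PARABOLA TAIL is a TWO-SHOT kill (quasi-homogeneous root (3,1,2) + ONE graph member)

[OURS · L1 W4.5c · lead-1 g16; plan-1 RULING R-F15n (2) / memo X-CERT/R4 §4 (TV-certified rows, `L/w45c/tv/TV-run2.log`): «R4a ★ `tparab_killsIn_two` (σ: x₁ ↦ x₁+x₀,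
x₂ ↦ x₂+x₀, x₃ ↦ x₃ + (x₂−x₁) − x₁²); LINEAR recoordination u = x₂ − x₁; ROOT (x₀:3, x₁:1, u:2; sh 2); [X₀] killed; MEMBER on [X₁] (X₀:2, φ = U − X₁²:1; sh 1), hunit −2X₁,
K1′ = graph lemma»; bricks ✓`…S1aQhRoot`, ✓`…S1aQhChartModel`, ✓`…S1aQhCover`, ✓`…S1aTparabCover`, ✓`…S1aTparabChartMember`, ✓`…S1aGraphShear`, ✓`…S1aSymMemberGraph`] —
NOT statements of the manuscript; counted 0; AI-level work, weaker than expert review. Crux stmt-ResolutionOfSingularities-17941 `CyclicQuotientFourfolds`, line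
`s1a-logminvertex` v13 (`stub_reachLowerInFX`).

Stated in the R4 NORMAL FORM (the recoordinated variable `x₂` is the invariant `u`): σ fixes `x₀, x₂`, `σx₁ = x₁ + x₀`, `σx₃ = x₃ + (x₂ − x₁²)`.
* `tparab_rootChartData` — the quasi-homogeneous root `(e⁻¹x₀ : 3, e⁻¹x₁ : 1, e⁻¹x₂ : 2)` is a legal move on the initial model (explicit root node);
* ★★★ `GameFrame.GModel.tparab_killsIn_two` — `KillsIn 2 (GModel.initial hq h₀)`: MOVE 1 the root with the 3-COVER `(x₀^{2p·dv}, N(x₁)^{6dv}, N(x₂−x₁²)^{3dv})` (`dbar = 6p·dv`);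
  the charts of `x₀` and of the tail norm are KILLED (`u₀′`, resp. `c₂`, lie in the residual ideal `𝔞 = (aug σ_R : s²)`), the `[N(x₁)]`-chart holds the whole residual
  `F₁ = {X₀′ = 0, X₂′ = X₁′²}`; MOVE 2 = ONE graph member ✓`exists_isPrincipalCentre_of_tparabChart` (hunit `−2X₁′`, needs `p ≠ 2`), separated by the transition sections;
* ★★★ `GameFrame.GModel.exists_reachLowerF_initial_of_tparab` — the conclusion of `ReachLowerInF(X)` for every root decoration (class of the research stub);
* ★★★ `tparabCensus_killsIn_two` / `exists_reachLowerF_initial_of_tparabCensus` — the same in the CENSUS coordinates of R-F15n (σ: x₁ ↦ x₁+x₀, x₂ ↦ x₂+x₀,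
  x₃ ↦ x₃ + (x₂−x₁) − x₁²), by the linear recoordination `u = x₂ − x₁` absorbed into `e` (✓`FreeModel.exists_linShear`).
-/

set_option linter.dupNamespace false

noncomputable section

open CategoryTheory Limits AlgebraicGeometry TopologicalSpace Topology Opposite MvPolynomial
open Literature.AlgebraicGeometry.Resolution Literature.AlgebraicGeometry.RelativeSpec
open scoped LaurentPolynomial
open Summit.ResolutionOfSingularities.ResolutionOfSingularities.Theorems.WildQuotientResolution.S1
open Summit.ResolutionOfSingularities.ResolutionOfSingularities.Theorems.WildQuotientResolution.S1.NodeAtlas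
open Summit.ResolutionOfSingularities.ResolutionOfSingularities.Theorems.WildQuotientResolution.S1.CoarseChart
open Summit.ResolutionOfSingularities.ResolutionOfSingularities.Theorems.WildQuotientResolution.S1.ProducerStep
open Summit.ResolutionOfSingularities.ResolutionOfSingularities.Theorems.WildQuotientResolution.S1.NpFrame
open Summit.ResolutionOfSingularities.ResolutionOfSingularities.Theorems.WildQuotientResolution.S1.GoodCharts
open Summit.ResolutionOfSingularities.ResolutionOfSingularities.Theorems.WildQuotientResolution.S1.BlowupCharts
open Summit.ResolutionOfSingularities.ResolutionOfSingularities.Theorems.WildQuotientResolution.S1.KillableTransport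
open Summit.ResolutionOfSingularities.ResolutionOfSingularities.Theorems.WildQuotientResolution.S1.KillCert
open Summit.ResolutionOfSingularities.ResolutionOfSingularities.Theorems.WildQuotientResolution.S1.ReesBigrading
open Summit.ResolutionOfSingularities.ResolutionOfSingularities.Theorems.WildQuotientResolution.S1.NodeTransport
open Summit.ResolutionOfSingularities.ResolutionOfSingularities.Theorems.WildQuotientResolution.S1.CobordantTransport
open Summit.ResolutionOfSingularities.ResolutionOfSingularities.Theorems.WildQuotientResolution.BlowupExit
open Summit.ResolutionOfSingularities.ResolutionOfSingularities.Theorems.WildQuotientResolution.S1.KillGlue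
open Summit.ResolutionOfSingularities.ResolutionOfSingularities.Theorems.WildQuotientResolution.S1.FreeModel
open Summit.ResolutionOfSingularities.ResolutionOfSingularities.Theorems.WildQuotientResolution.S1.ModelNode

namespace Summit.ResolutionOfSingularities.ResolutionOfSingularities.Theorems.WildQuotientResolution.S1.GameFrame.GModel

variable {p : ℕ} {X' X₁ : Scheme.{0}} {q : X' ⟶ X₁} {G : Type} [Group G] {ρ : G →* Aut X'} {g₀ : G}

/-- ★ **THE QUASI-HOMOGENEOUS ROOT `(3,1,2)` OF THE TANGENT PARABOLA IS A LEGAL MOVE, with the explicit root node** (pattern ✓`symT_rootChartData`).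
[OURS · L1 W4.5c · R4a root, scheme level] -/
theorem tparab_rootChartData [Finite G] (hp : p.Prime) (hG : ∀ g : G, g ∈ Subgroup.zpowers g₀) (hg₀ : g₀ ^ p = 1)
    (hq : ∀ g : G, (ρ g).hom ≫ q = q) [IsIntegral X'] [IsLocallyNoetherian X'] [X'.IsSeparated]
    (hreg : Scheme.IsRegular X') {k : Type} [Field k] (σ : MvPolynomial (Fin 4) k ≃+* MvPolynomial (Fin 4) k) (hC : ∀ a : k, σ (C a) = C a)
    (h0 : σ (X 0) = X 0) (h1 : σ (X 1) = X 1 + X 0) (h2 : σ (X 2) = X 2) (h3 : σ (X 3) = X 3 + (X 2 - X 1 ^ 2))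
    (h₀ : NodeAtlas p (⟨ρ, hq⟩ : ActionOver q G) g₀) (O : (GModel.initial (p := p) (g₀ := g₀) hq h₀).act.StableAffineOpens) (hO : IsAffineOpen O.1)
    (e : Γ(X', O.1) ≃+* MvPolynomial (Fin 4) k) (hact : ∀ x : Γ(X', O.1), actOEquiv (GModel.initial hq h₀).act O g₀ x = e.symm (σ (e x)))
    (hZcl : IsClosed (X'.zeroLocus (U := O.1) (Set.range (e.symm ∘ ![X 0, X 1, X 2] : Fin 3 → Γ(X', O.1))) ∩ (O.1 : Set (GModel.initial (p := p) (g₀ := g₀) hq h₀).V))) :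
    ∃ (𝒜 : (Π j : Fin 0, ZMod ((![] : Fin 0 → ℕ) j)) → AddSubgroup Γ(X', O.1)) (_ : GradedRing 𝒜) (e' : Γ(X', O.1) ≃+* ↥(𝒜 0))
      (𝒦 : ReesFiltration X') (d : ℕ),
      (∀ i, 𝒜 i = ⊤) ∧ (∀ b, ((e' b : ↥(𝒜 0)) : Γ(X', O.1)) = b) ∧
      IsTameNode p Γ(X', O.1) 𝒜 (actOEquiv (GModel.initial hq h₀).act O g₀) ∧ (∀ x, (⇑(actOEquiv (GModel.initial hq h₀).act O g₀))^[p] x = x) ∧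
      (∀ t : Γ(X', O.1), ((e' (((GModel.initial hq h₀).act.aut g₀⁻¹).hom.appLE O.1 O.1 (O.2.1 g₀⁻¹).ge t) : ↥(𝒜 0)) : Γ(X', O.1)) =
        actOEquiv (GModel.initial hq h₀).act O g₀ ((e' t : ↥(𝒜 0)) : Γ(X', O.1))) ∧
      VeroneseNormalised 𝒜 (e.symm ∘ ![X 0, X 1, X 2]) ![3, 1, 2] d ∧
      IsAdmissibleCentre p (GModel.initial hq h₀).act g₀ 𝒦 d ∧ IsCentreChart p (GModel.initial hq h₀).act g₀ 𝒦 d O ∧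
      (∀ (g : G) (n : ℕ), (𝒦.ideal n).comap ((GModel.initial hq h₀).act.aut g).hom = 𝒦.ideal n) ∧
      (∀ n, (𝒦.filtration ⟨O.1, hO⟩).ideal n = ((traceFiltration 𝒜 (e.symm ∘ ![X 0, X 1, X 2]) ![3, 1, 2]).ideal n).comap (e' : Γ(X', O.1) →+* ↥(𝒜 0))) ∧
      (((𝒦.ideal d).support : Set X')) = X'.zeroLocus (U := O.1) (Set.range (e.symm ∘ ![X 0, X 1, X 2] : Fin 3 → Γ(X', O.1))) ∩ (O.1 : Set (GModel.initial (p := p) (g₀ := g₀) hq h₀).V) := by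
  haveI hsep : (GModel.initial (p := p) (g₀ := g₀) hq h₀).V.IsSeparated := ‹X'.IsSeparated›
  have _ := hp.pos
  have hw0 : (![3, 1, 2] : Fin 3 → ℕ) 0 = (![3, 1, 2] : Fin 3 → ℕ) 1 + 2 := rfl
  obtain ⟨𝒜, gr, e', 𝒦, d, h𝒜, he', htame, hσp, hσ, -, hver, hadm, hcentre, hG𝒦, -, h𝒦tr, hsupp⟩ :=
    exists_isAdmissibleCentre_of_chartData (p := p) hG hg₀ (GModel.initial hq h₀) hreg O hO (e.symm ∘ ![X 0, X 1, X 2]) ![3, 1, 2] (by norm_num)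
      (fun i => by fin_cases i <;> simp) (Sym.sym_isRegular e) (Sym.sym_isRegularRing_quotient e)
      (fun n => Qh.qh_map_le σ hC h0 h1 h2 ![3, 1, 2] 2 (X 2 - X 1 ^ 2) h3 e (actOEquiv (GModel.initial hq h₀).act O g₀) hact hw0 (Tparab.tparab_tail_mem e) n) hZcl
  exact ⟨𝒜, gr, e', 𝒦, d, h𝒜, he', htame, hσp, hσ, hver, hadm, hcentre, hG𝒦, h𝒦tr, hsupp⟩

set_option maxHeartbeats 8000000 in
set_option synthInstance.maxHeartbeats 400000 in
/-- ★★★ **R4a: `KillsIn 2` FOR THE INITIAL MODEL OF THE TANGENT-PARABOLA TAIL** (R4 normal form). See the module docstring.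
[OURS · L1 W4.5c · R-F15n R4a; NOT a statement of the manuscript] -/
theorem tparab_killsIn_two [Finite G] (hp : p.Prime) (hG : ∀ g : G, g ∈ Subgroup.zpowers g₀) (hg₀ : g₀ ^ p = 1)
    (hq : ∀ g : G, (ρ g).hom ≫ q = q) [IsIntegral X'] [IsLocallyNoetherian X'] [X'.IsSeparated] [IsAffine X']
    (hreg : Scheme.IsRegular X') {k' : Type} [Field k'] (φ : X₁ ⟶ Spec (.of k')) [IsSeparated φ] [LocallyOfFiniteType φ] [IsFinite q]
    {k : Type} [Field k] [CharP k p] (hp2 : p ≠ 2) (σ : MvPolynomial (Fin 4) k ≃+* MvPolynomial (Fin 4) k) (hC : ∀ a : k, σ (C a) = C a)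
    (h0 : σ (X 0) = X 0) (h1 : σ (X 1) = X 1 + X 0) (h2 : σ (X 2) = X 2) (h3 : σ (X 3) = X 3 + (X 2 - X 1 ^ 2))
    (e : Γ(X', ⊤) ≃+* MvPolynomial (Fin 4) k)
    (hστ : ∀ t : Γ(X', ⊤), e ((ρ g₀⁻¹).hom.appLE ⊤ ⊤ (by rw [Scheme.Hom.preimage_top]) t) = σ (e t))
    (h₀ : NodeAtlas p (⟨ρ, hq⟩ : ActionOver q G) g₀) :
    KillsIn 2 (GModel.initial (p := p) (g₀ := g₀) hq h₀) := by
  classical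
  haveI : NeZero p := ⟨hp.ne_zero⟩
  have hp1 : p ≠ 1 := hp.one_lt.ne'
  have hk2 : (2 : k) ≠ 0 := by
    intro h
    have h' : ((2 : ℕ) : k) = 0 := by exact_mod_cast h
    rw [CharP.cast_eq_zero_iff k p] at h'
    exact hp2 ((Nat.prime_dvd_prime_iff_eq hp Nat.prime_two).mp h')
  have hw0 : (![3, 1, 2] : Fin 3 → ℕ) 0 = (![3, 1, 2] : Fin 3 → ℕ) 1 + 2 := rfl
  -- the root chart `O = X′`
  haveI : IsAffine (⊤ : X'.Opens) := isAffineOpen_top X'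
  have hAff : IsAffineHom ((⊤ : X'.Opens).ι ≫ q) := inferInstance
  have hst : ∀ g : G, (ρ g).hom ⁻¹ᵁ (⊤ : X'.Opens) = ⊤ := fun g => Scheme.Hom.preimage_top _
  let O : (GModel.initial (p := p) (g₀ := g₀) hq h₀).act.StableAffineOpens := ⟨⊤, hst, hAff⟩
  have hO : IsAffineOpen O.1 := isAffineOpen_top X'
  haveI hsep₀ : (GModel.initial (p := p) (g₀ := g₀) hq h₀).V.IsSeparated := ‹X'.IsSeparated›
  obtain ⟨e₀, he₀⟩ : ∃ e₀ : Γ(X', O.1) ≃+* MvPolynomial (Fin 4) k, ∀ t, e₀ t = e t := ⟨e, fun _ => rfl⟩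
  have hact : ∀ t : Γ(X', O.1), actOEquiv (GModel.initial hq h₀).act O g₀ t = e₀.symm (σ (e₀ t)) := fun t => by
    apply e₀.injective
    rw [e₀.apply_symm_apply, he₀, he₀, ← hστ]
    rfl
  obtain ⟨τ₀, hτ₀⟩ : ∃ τ₀ : Γ(X', O.1) ≃+* Γ(X', O.1), τ₀ = actOEquiv (GModel.initial hq h₀).act O g₀ := ⟨_, rfl⟩
  have hact₀ : ∀ t : Γ(X', O.1), τ₀ t = e₀.symm (σ (e₀ t)) := fun t => by rw [hτ₀]; exact hact t
  -- the quasi-homogeneous centre `(e⁻¹x₀ : 3, e⁻¹x₁ : 1, e⁻¹x₂ : 2)`, shift 2, tail `x₂ − x₁² ∈ 𝒥₂`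
  have ht := Tparab.tparab_tail_mem e₀
  have hσJ : ∀ n : ℕ, ((weightedFiltration (e₀.symm ∘ ![X 0, X 1, X 2] : Fin 3 → Γ(X', O.1)) ![3, 1, 2]).ideal n).map (τ₀ : Γ(X', O.1) →+* Γ(X', O.1)) ≤ (weightedFiltration (e₀.symm ∘ ![X 0, X 1, X 2] : Fin 3 → Γ(X', O.1)) ![3, 1, 2]).ideal n :=
    fun n => Qh.qh_map_le σ hC h0 h1 h2 ![3, 1, 2] 2 (X 2 - X 1 ^ 2) h3 e₀ τ₀ hact₀ hw0 ht n
  have hw : ∀ i, 0 < (![3, 1, 2] : Fin 3 → ℕ) i := fun i => by fin_cases i <;> simp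
  have hK1 := Sym.sym_isRegular e₀
  have hK1' := Sym.sym_isRegularRing_quotient e₀
  have hZcl : IsClosed (X'.zeroLocus (U := O.1) (Set.range (e₀.symm ∘ ![X 0, X 1, X 2] : Fin 3 → Γ(X', O.1))) ∩ (O.1 : Set (GModel.initial (p := p) (g₀ := g₀) hq h₀).V)) :=
    (X'.zeroLocus_isClosed _).inter (by exact isClosed_univ)
  obtain ⟨𝒜, gr, e', 𝒦, dv, h𝒜, he', htame, hσp, hσ, hver, hadm, -, hG𝒦, h𝒦tr, -⟩ :=
    tparab_rootChartData hp hG hg₀ hq hreg σ hC h0 h1 h2 h3 h₀ O hO e₀ hact hZcl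
  letI : GradedRing 𝒜 := gr
  have htame₀ : IsTameNode p Γ(X', O.1) 𝒜 τ₀ := by rw [hτ₀]; exact htame
  have hσp₀ : ∀ x : Γ(X', O.1), (⇑τ₀)^[p] x = x := by rw [hτ₀]; exact hσp
  have hσ₀ : ∀ t : Γ(X', O.1), ((e' (((GModel.initial hq h₀).act.aut g₀⁻¹).hom.appLE O.1 O.1 (O.2.1 g₀⁻¹).ge t) : ↥(𝒜 0)) : Γ(X', O.1)) =
      τ₀ ((e' t : ↥(𝒜 0)) : Γ(X', O.1)) := fun t => by rw [hτ₀]; exact hσ t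
  refine ⟨𝒦, dv, hadm, fun M₁ hm₁ => ⟨⟨NodeAtlasData.ofNodeAtlas (p := p) (ρ := M₁.act) (g₀ := g₀) M₁.atlas⟩, ?_⟩⟩
  obtain ⟨π₁, hbl, -, hrM, hcomm⟩ := hm₁
  haveI : M₁.V.IsSeparated := isSeparated_of_datum φ M₁
  -- ### MOVE 1 on the realisation `M₁`: the three producer charts and the atlas `𝔄₁`
  haveI hchar : CharP Γ(X', O.1) p := charP_of_injective_ringHom (f := e₀.symm.toRingHom) e₀.symm.injective p
  have hdv : 0 < dv := hver.1
  have hk : 0 < 6 * p := Nat.mul_pos (by norm_num) hp.pos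
  have hn₀ : 0 < 2 * p * dv := Nat.mul_pos (Nat.mul_pos two_pos hp.pos) hdv
  have hn₁ : 0 < 6 * dv := Nat.mul_pos (by norm_num) hdv
  have hn₂ : 0 < 3 * dv := Nat.mul_pos (by norm_num) hdv
  have hd₀ : dv * (6 * p) = (![3, 1, 2] : Fin 3 → ℕ) 0 * (2 * p * dv) := by change dv * (6 * p) = 3 * (2 * p * dv); ring
  have hd₁ : dv * (6 * p) = p * (![3, 1, 2] : Fin 3 → ℕ) 1 * (6 * dv) := by change dv * (6 * p) = p * 1 * (6 * dv); ring
  have hd₂ : dv * (6 * p) = 2 * p * (3 * dv) := by ring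
  have hf : ∀ i, (e₀.symm ∘ ![X 0, X 1, X 2] : Fin 3 → Γ(X', O.1)) i ∈ 𝒜 ((fun _ => (0 : Π j : Fin 0, ZMod ((![] : Fin 0 → ℕ) j))) i) := fun i => by
    rw [h𝒜]; trivial
  -- the 3-cover, kept opaque
  obtain ⟨cov, hcov⟩ : ∃ cov : Fin 3 → Γ(X', O.1), cov = ![e₀.symm (X 0) ^ (2 * p * dv),
      (∏ i : ZMod p, (e₀.symm (X 1) + (i.val : Γ(X', O.1)) * e₀.symm (X 0))) ^ (6 * dv),
      (∏ i : ZMod p, (e₀.symm (X 2) - (e₀.symm (X 1) + (i.val : Γ(X', O.1)) * e₀.symm (X 0)) ^ 2)) ^ (3 * dv)] := ⟨_, rfl⟩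
  have hcov0 : cov 0 = e₀.symm (X 0) ^ (2 * p * dv) := by rw [hcov]; rfl
  have hcov1 : cov 1 = (∏ i : ZMod p, (e₀.symm (X 1) + (i.val : Γ(X', O.1)) * e₀.symm (X 0))) ^ (6 * dv) := by rw [hcov]; rfl
  have hcov2 : cov 2 = (∏ i : ZMod p, (e₀.symm (X 2) - (e₀.symm (X 1) + (i.val : Γ(X', O.1)) * e₀.symm (X 0)) ^ 2)) ^ (3 * dv) := by rw [hcov]; rfl
  obtain ⟨y, hydef⟩ : ∃ y : Fin 3 → ↥(𝒜 0), y = fun j => e' (cov j) := ⟨_, rfl⟩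
  have hyval : ∀ j, (y j).1 = cov j := fun j => by rw [hydef]; exact he' (cov j)
  have hy : ∀ j, y j ∈ (traceFiltration 𝒜 (e₀.symm ∘ ![X 0, X 1, X 2] : Fin 3 → Γ(X', O.1)) ![3, 1, 2]).ideal (dv * (6 * p)) := fun j => by
    rw [mem_traceFiltration_iff, hyval]
    refine Fin.cases ?_ (Fin.cases ?_ (Fin.cases ?_ (fun l => l.elim0))) j
    · rw [hcov0]; exact Qh.qh_cover_zero_mem ![3, 1, 2] e₀ _ _ hd₀
    · change cov 1 ∈ _; rw [hcov1]; exact Qh.qh_cover_one_mem ![3, 1, 2] 2 e₀ hw0 (p := p) _ _ hd₁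
    · change cov 2 ∈ _; rw [hcov2]; exact Tparab.tparab_cover_two_mem e₀ (p := p) _ _ hd₂
  have hσy : ∀ j, τ₀ (y j).1 = (y j).1 := fun j => by
    rw [hyval]
    refine Fin.cases ?_ (Fin.cases ?_ (Fin.cases ?_ (fun l => l.elim0))) j
    · rw [hcov0]; exact Sym.sym_cover_zero_fixed σ h0 e₀ τ₀ hact₀ _
    · change τ₀ (cov 1) = cov 1; rw [hcov1]; exact Qh.qh_cover_one_fixed σ h0 h1 e₀ τ₀ hact₀ hp1 _
    · change τ₀ (cov 2) = cov 2; rw [hcov2]; exact Tparab.tparab_cover_two_fixed σ h0 h1 h2 e₀ τ₀ hact₀ hp1 _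
  -- the cover elements in `R^w`
  have hc0 := Qh.qh_coverElement_zero_eq ![3, 1, 2] e₀ ![] 𝒜 (y 0) (hy 0) (2 * p * dv) hd₀ (by rw [hyval, hcov0])
  have hc1 := Qh.qh_coverElement_one_eq ![3, 1, 2] 2 e₀ hw0 ![] 𝒜 (y 1) (hy 1) (6 * dv) hd₁ (by rw [hyval, hcov1])
  have hc2 := Tparab.tparab_coverElement_two_eq e₀ ![] 𝒜 (y 2) (hy 2) (3 * dv) hd₂ (by rw [hyval, hcov2])
  have hrad : ∀ l : Fin 3, cobordantAlgebra.u' (e₀.symm ∘ ![X 0, X 1, X 2] : Fin 3 → Γ(X', O.1)) ![3, 1, 2] l ∈ (Ideal.span (Set.range fun j => coverElement 𝒜 (e₀.symm ∘ ![X 0, X 1, X 2]) ![3, 1, 2] (dv * (6 * p)) (y j) (hy j))).radical :=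
    fun l => Tparab.tparab_hrad e₀ (fun j => coverElement 𝒜 (e₀.symm ∘ ![X 0, X 1, X 2]) ![3, 1, 2] (dv * (6 * p)) (y j) (hy j)) hn₀ hn₁ hc0 hc1 hc2 l
  -- (H1) with `g = s²` and the residual ideal `𝔞`: `u₀′ ∈ 𝔞`, `c₂ ∈ 𝔞`
  have hH1 := Qh.qh_augmentationIdeal_sigmaR_le σ hC h0 h1 h2 ![3, 1, 2] 2 _ h3 e₀ τ₀ hact₀ hw0 ht hp.pos hσp₀ hσJ
  have hmem0 := Qh.qh_u'_zero_mem_residual σ h1 ![3, 1, 2] 2 e₀ τ₀ hact₀ hw0 hp.pos hσp₀ hσJ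
  have hmem2 := Qh.qh_mem_residual_of_dvd ![3, 1, 2] 2 e₀ τ₀ hp.pos hσp₀ hσJ (Tparab.tparab_tail_dvd_coverElement_two e₀ ![] 𝒜 (y 2) (hy 2) (3 * dv) hn₂ hd₂ (by rw [hyval, hcov2]))
    (Qh.qh_tail_mem_residual σ ![3, 1, 2] 2 _ h3 e₀ τ₀ hact₀ ht hp.pos hσp₀ hσJ)
  have hz0 := fun j => Qh.qh_residualSection_zero ![3, 1, 2] e₀ ![] 𝒜 hf (y j) (hy j) (2 * p * dv) hd₀ _ hmem0 hn₀
  have hz2 := fun j => Qh.qh_residualSection_of_mem ![3, 1, 2] e₀ ![] 𝒜 hf (y j) (hy j) (y 2) (hy 2) _ hmem2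
  have hsuppO : (((𝒦.ideal dv).support : Set X')) ⊆ (O.1 : Set (GModel.initial (p := p) (g₀ := g₀) hq h₀).V) := fun x _ => Set.mem_univ x
  obtain ⟨OW, hOWaff, hOWeq, E, htame', hE', hpin, 𝔄₁, hF₁⟩ := exists_moveAtlas_of_node hp.pos hG (GModel.initial hq h₀) M₁
    (NodeAtlasData.ofNodeAtlas (p := p) (ρ := (⟨ρ, hq⟩ : ActionOver q G)) (g₀ := g₀) h₀) O hO
    ![] 𝒜 (e₀.symm ∘ ![X 0, X 1, X 2]) ![3, 1, 2] hf τ₀ e' htame₀ hσp₀ hσ₀ hw hK1 hK1' hσJ 𝒦 dv hG𝒦 h𝒦tr hver hsuppO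
    π₁ hbl hrM hcomm hk y hy hσy hrad (cobordantAlgebra.s (e₀.symm ∘ ![X 0, X 1, X 2]) ![3, 1, 2] ^ 2) hH1 (fun _ => 2)
    (fun j => ![algebraMap _ (ChartRing 𝒜 (e₀.symm ∘ ![X 0, X 1, X 2]) ![3, 1, 2] (dv * (6 * p)) (y j) (hy j)) (cobordantAlgebra.u' (e₀.symm ∘ ![X 0, X 1, X 2]) ![3, 1, 2] 0 ^ (2 * p * dv)) * IsLocalization.Away.invSelf (coverElement 𝒜 (e₀.symm ∘ ![X 0, X 1, X 2]) ![3, 1, 2] (dv * (6 * p)) (y j) (hy j)),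
      algebraMap _ (ChartRing 𝒜 (e₀.symm ∘ ![X 0, X 1, X 2]) ![3, 1, 2] (dv * (6 * p)) (y j) (hy j)) (coverElement 𝒜 (e₀.symm ∘ ![X 0, X 1, X 2]) ![3, 1, 2] (dv * (6 * p)) (y 2) (hy 2)) * IsLocalization.Away.invSelf (coverElement 𝒜 (e₀.symm ∘ ![X 0, X 1, X 2]) ![3, 1, 2] (dv * (6 * p)) (y j) (hy j))])
    (fun j l => Fin.cases (hz0 j).1 (Fin.cases (hz2 j).1 (fun l' => l'.elim0)) l) (fun j l => Fin.cases (hz0 j).2 (Fin.cases (hz2 j).2 (fun l' => l'.elim0)) l)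
  have hWle : ∀ j, (OW j).1 ≤ π₁ ⁻¹ᵁ O.1 := fun j => by rw [hOWeq j]; exact blowupChart_le_preimage π₁ _ ⟨O.1, hO⟩ _
  -- ### charts 0 and 2 are killed
  have hunit0 : algebraMap _ (ChartRing 𝒜 (e₀.symm ∘ ![X 0, X 1, X 2]) ![3, 1, 2] (dv * (6 * p)) (y 0) (hy 0)) (cobordantAlgebra.u' (e₀.symm ∘ ![X 0, X 1, X 2]) ![3, 1, 2] 0 ^ (2 * p * dv)) * IsLocalization.Away.invSelf (coverElement 𝒜 (e₀.symm ∘ ![X 0, X 1, X 2]) ![3, 1, 2] (dv * (6 * p)) (y 0) (hy 0)) = 1 := by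
    rw [← hc0]; exact IsLocalization.Away.mul_invSelf _
  have hunit2 : algebraMap _ (ChartRing 𝒜 (e₀.symm ∘ ![X 0, X 1, X 2]) ![3, 1, 2] (dv * (6 * p)) (y 2) (hy 2)) (coverElement 𝒜 (e₀.symm ∘ ![X 0, X 1, X 2]) ![3, 1, 2] (dv * (6 * p)) (y 2) (hy 2)) * IsLocalization.Away.invSelf (coverElement 𝒜 (e₀.symm ∘ ![X 0, X 1, X 2]) ![3, 1, 2] (dv * (6 * p)) (y 2) (hy 2)) = 1 :=
    IsLocalization.Away.mul_invSelf _
  have hz0W : ∀ v ∈ (OW 0).1, v ∈ M₁.V.basicOpen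
      (letI := chartNodeGradedRing ![] 𝒜 (e₀.symm ∘ ![X 0, X 1, X 2]) ![3, 1, 2] hf (dv * (6 * p)) (y 0) (hy 0); (E 0).symm ⟨_, (hz0 0).1⟩) := fun v hv => by
    letI := chartNodeGradedRing ![] 𝒜 (e₀.symm ∘ ![X 0, X 1, X 2]) ![3, 1, 2] hf (dv * (6 * p)) (y 0) (hy 0)
    have h1 : (⟨_, (hz0 0).1⟩ : ↥(chartNodeGrading ![] 𝒜 (e₀.symm ∘ ![X 0, X 1, X 2]) ![3, 1, 2] hf (dv * (6 * p)) (y 0) (hy 0) 0)) = 1 := Subtype.ext hunit0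
    rw [h1, map_one, Scheme.basicOpen_of_isUnit _ isUnit_one]
    exact hv
  have hz2W : ∀ v ∈ (OW 2).1, v ∈ M₁.V.basicOpen
      (letI := chartNodeGradedRing ![] 𝒜 (e₀.symm ∘ ![X 0, X 1, X 2]) ![3, 1, 2] hf (dv * (6 * p)) (y 2) (hy 2); (E 2).symm ⟨_, (hz2 2).1⟩) := fun v hv => by
    letI := chartNodeGradedRing ![] 𝒜 (e₀.symm ∘ ![X 0, X 1, X 2]) ![3, 1, 2] hf (dv * (6 * p)) (y 2) (hy 2)
    have h1 : (⟨_, (hz2 2).1⟩ : ↥(chartNodeGrading ![] 𝒜 (e₀.symm ∘ ![X 0, X 1, X 2]) ![3, 1, 2] hf (dv * (6 * p)) (y 2) (hy 2) 0)) = 1 := Subtype.ext hunit2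
    rw [h1, map_one, Scheme.basicOpen_of_isUnit _ isUnit_one]
    exact hv
  have hF₁W : 𝔄₁.fLocus ⊆ ⋃ _ : Unit, (((OW 1)).1 : Set M₁.V) := by
    intro v hv
    rcases hF₁ hv with hold | hnew
    · exact absurd (Set.mem_univ _) hold.2
    · obtain ⟨j, hvW, hvR⟩ := Set.mem_iUnion.mp hnew
      revert hvW hvR
      refine Fin.cases ?_ (Fin.cases ?_ (Fin.cases ?_ (fun l => l.elim0))) j
      · intro hvW hvR; exact absurd (hz0W v hvW) (hvR 0)
      · intro hvW _; exact Set.mem_iUnion.mpr ⟨(), hvW⟩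
      · intro hvW hvR; exact absurd (hz2W v hvW) (hvR 1)
  -- ### the charts cover `M₁`
  have hπ' : IsBlowup π₁ ((𝒦.ideal dv) ^ (6 * p)) := isBlowup_pow hbl hk.ne'
  have hverbar := CoarseChart.veroneseNormalised_mul 𝒜 _ _ hver hk
  have hJ' : ((𝒦.ideal dv) ^ (6 * p)).ideal ⟨O.1, hO⟩ =
      ((traceFiltration 𝒜 (e₀.symm ∘ ![X 0, X 1, X 2]) ![3, 1, 2]).ideal (dv * (6 * p))).comap (e' : Γ(X', O.1) →+* ↥(𝒜 0)) := by
    rw [Scheme.IdealSheafData.ideal_pow, Pi.pow_apply, ← ReesFiltration.filtration_ideal, h𝒦tr dv, hver.2 (6 * p), comap_equiv_pow]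
  have hxJ : ∀ j, e'.symm (y j) ∈ ((𝒦.ideal dv) ^ (6 * p)).ideal ⟨O.1, hO⟩ := fun j => by
    rw [hJ', Ideal.mem_comap, RingHom.coe_coe, e'.apply_symm_apply]; exact hy j
  have hcovM : ∀ x : M₁.V, ∃ j, x ∈ (OW j).1 := by
    intro x
    have hcovW := iSup_blowupChart_eq_preimage (I := 𝒦.ideal dv) (GModel.initial hq h₀).act ![] 𝒜 (e₀.symm ∘ ![X 0, X 1, X 2]) ![3, 1, 2] hf O hO e' hπ' hverbar hJ' y hy hrad
    have hx : x ∈ ⨆ j, blowupChart π₁ ((𝒦.ideal dv) ^ (6 * p)) ⟨O.1, hO⟩ (e'.symm (y j)) :=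
      (congrArg (fun U : M₁.V.Opens => x ∈ U) hcovW).mpr (Set.mem_univ _)
    obtain ⟨j, hj⟩ := Opens.mem_iSup.mp hx
    exact ⟨j, (congrArg (fun U : M₁.V.Opens => x ∈ U) (hOWeq j)).mpr hj⟩
  -- ### the transition sections
  have htrans : ∀ j j' : Fin 3, letI := chartNodeGradedRing ![] 𝒜 (e₀.symm ∘ ![X 0, X 1, X 2]) ![3, 1, 2] hf (dv * (6 * p)) (y j) (hy j)
      ∃ t : Γ(M₁.V, (OW j).1),
        ((E j t : ↥(chartNodeGrading ![] 𝒜 (e₀.symm ∘ ![X 0, X 1, X 2]) ![3, 1, 2] hf (dv * (6 * p)) (y j) (hy j) 0)) : (ChartRing 𝒜 (e₀.symm ∘ ![X 0, X 1, X 2]) ![3, 1, 2] (dv * (6 * p)) (y j) (hy j))) = algebraMap _ (ChartRing 𝒜 (e₀.symm ∘ ![X 0, X 1, X 2]) ![3, 1, 2] (dv * (6 * p)) (y j) (hy j)) (coverElement 𝒜 (e₀.symm ∘ ![X 0, X 1, X 2]) ![3, 1, 2] (dv * (6 * p)) (y j') (hy j')) * IsLocalization.Away.invSelf (coverElement 𝒜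 (e₀.symm ∘ ![X 0, X 1, X 2]) ![3, 1, 2] (dv * (6 * p)) (y j) (hy j)) ∧
        ∀ v ∈ (OW j).1, v ∈ (OW j').1 → v ∈ M₁.V.basicOpen t := by
    intro j j'
    letI := chartNodeGradedRing ![] 𝒜 (e₀.symm ∘ ![X 0, X 1, X 2]) ![3, 1, 2] hf (dv * (6 * p)) (y j) (hy j)
    have hmem := transitionSection_mem_chartNodeGrading_zero ![] 𝒜 (e₀.symm ∘ ![X 0, X 1, X 2]) ![3, 1, 2] hf (y j) (hy j) (y j') (hy j')
    have hpz : (E j).symm ⟨_, hmem⟩ * π₁.appLE O.1 (OW j).1 (hWle j) (e'.symm (y j)) = π₁.appLE O.1 (OW j).1 (hWle j) (e'.symm (y j')) :=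
      symm_mul_appLE_eq_of_pin π₁ O.1 (OW j).1 (hWle j) (chartNodeGrading ![] 𝒜 (e₀.symm ∘ ![X 0, X 1, X 2]) ![3, 1, 2] hf (dv * (6 * p)) (y j) (hy j)) (E j) e'
        (toChartRing 𝒜 (e₀.symm ∘ ![X 0, X 1, X 2]) ![3, 1, 2] (dv * (6 * p)) (y j) (hy j)) (hpin j (hWle j)) ⟨_, hmem⟩ (e'.symm (y j')) (e'.symm (y j)) (y j') (y j)
        (e'.apply_symm_apply _) (e'.apply_symm_apply _) (coverElement_section_pin ![] 𝒜 (e₀.symm ∘ ![X 0, X 1, X 2]) ![3, 1, 2] (y j) (hy j) (y j') (hy j'))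
    refine ⟨(E j).symm ⟨_, hmem⟩, by rw [(E j).apply_symm_apply], fun v hvW hv' => ?_⟩
    exact mem_basicOpen_of_mem_blowupChart_of_mul_appLE_eq hπ' ⟨O.1, hO⟩ (hxJ j) (le_of_eq (hOWeq j)) _ hpz hvW
      ((congrArg (fun U : M₁.V.Opens => v ∈ U) (hOWeq j')).mp hv')
  choose tr htrE htrU using htrans
  -- ### the free model and the model values of the cover
  obtain ⟨Ψ, hΨa, hΨs, hΨu⟩ := Qh.exists_qhRootModel ![3, 1, 2] e₀
  have hΨc0 : Ψ (coverElement 𝒜 (e₀.symm ∘ ![X 0, X 1, X 2]) ![3, 1, 2] (dv * (6 * p)) (y 0) (hy 0)) = X (some 0) ^ (2 * p * dv) :=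
    Qh.qh_model_coverElement_zero ![3, 1, 2] e₀ ![] 𝒜 (y 0) (hy 0) Ψ hΨu (2 * p * dv) hd₀ (by rw [hyval, hcov0])
  have hΨc1 : Ψ (coverElement 𝒜 (e₀.symm ∘ ![X 0, X 1, X 2]) ![3, 1, 2] (dv * (6 * p)) (y 1) (hy 1)) =
      (∏ i : ZMod p, (X (some 1) + (i.val : MvPolynomial (Option (Fin 4)) k) * (X (some 0) * X none ^ 2))) ^ (6 * dv) :=
    Qh.qh_model_coverElement_one ![3, 1, 2] 2 e₀ hw0 ![] 𝒜 (y 1) (hy 1) Ψ hΨs hΨu (6 * dv) hd₁ (by rw [hyval, hcov1])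
  have hΨc2 : Ψ (coverElement 𝒜 (e₀.symm ∘ ![X 0, X 1, X 2]) ![3, 1, 2] (dv * (6 * p)) (y 2) (hy 2)) =
      (∏ i : ZMod p, (X (some 2) - (X (some 1) + (i.val : MvPolynomial (Option (Fin 4)) k) * (X (some 0) * X none ^ 2)) ^ 2)) ^ (3 * dv) :=
    Tparab.tparab_model_coverElement_two e₀ ![] 𝒜 (y 2) (hy 2) Ψ hΨs hΨu (3 * dv) hd₂ (by rw [hyval, hcov2])
  have hdvd1 : (X (some 1) : MvPolynomial (Option (Fin 4)) k) ∣ Ψ (coverElement 𝒜 (e₀.symm ∘ ![X 0, X 1, X 2]) ![3, 1, 2] (dv * (6 * p)) (y 1) (hy 1)) := by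
    rw [hΨc1]; exact Tparab.tparab_model_dvd_one (p := p) 2 (6 * dv) hn₁
  have hu1 : MvPolynomial.eval (fun o : Option (Fin 4) => o.elim (0 : k) ![0, 1, 1, 0]) (Ψ (coverElement 𝒜 (e₀.symm ∘ ![X 0, X 1, X 2]) ![3, 1, 2] (dv * (6 * p)) (y 1) (hy 1))) ≠ 0 := by
    rw [hΨc1]; exact Tparab.tparab_model_eval_one (p := p) 2 (6 * dv)
  have hΨv : ∀ j : {j : Fin 3 // j ≠ 1}, Ψ (coverElement 𝒜 (e₀.symm ∘ ![X 0, X 1, X 2]) ![3, 1, 2] (dv * (6 * p)) (y j.1) (hy j.1)) ∈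
      Ideal.span ({X (some 0), X (some 2) - X (some 1) ^ 2} : Set (MvPolynomial (Option (Fin 4)) k)) := by
    rintro ⟨j, hj⟩
    revert hj
    refine Fin.cases ?_ (Fin.cases ?_ (Fin.cases ?_ (fun l => l.elim0))) j
    · intro _
      change Ψ (coverElement 𝒜 (e₀.symm ∘ ![X 0, X 1, X 2]) ![3, 1, 2] (dv * (6 * p)) (y 0) (hy 0)) ∈ _
      rw [hΨc0]
      exact Ideal.pow_mem_of_mem _ (Ideal.subset_span (by simp)) _ hn₀
    · intro h; exact absurd rfl h
    · intro _
      change Ψ (coverElement 𝒜 (e₀.symm ∘ ![X 0, X 1, X 2]) ![3, 1, 2] (dv * (6 * p)) (y 2) (hy 2)) ∈ _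
      rw [hΨc2]
      exact Tparab.tparab_model_two_mem_span (p := p) (3 * dv) hn₂
  -- ### the Veronese degree and the graph member on chart 1
  obtain ⟨dV, hdV⟩ := exists_veroneseNormalised_tparabChart (p := p) e₀ τ₀ hp.pos hσp₀ hσJ ![] 𝒜 hf (y 1) (hy 1) (hσy 1) Ψ hΨu (htame' 1) ![2, 1]
  have hDpos : 0 < dV * 1 := Nat.mul_pos hdV.1 one_pos
  obtain ⟨J, hJ, hJW, hJsupp, hJoff, -⟩ := exists_isPrincipalCentre_of_tparabChart hG σ hC h0 h1 h2 h3 e₀ τ₀ hact₀ hp.pos hσp₀ hσJ hk2 ![] 𝒜 hf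
    (y 1) (hy 1) (hσy 1) Ψ hΨa hΨs hΨu M₁ (OW 1) (hOWaff 1) (E 1) (htame' 1) (hE' 1) hdvd1 hu1 dV 1 one_pos hdV
    (fun j : {j : Fin 3 // j ≠ 1} => (OW j.1).1)
    (fun x => by
      obtain ⟨j, hj⟩ := hcovM x
      by_cases hji : j = 1
      · exact Or.inl (hji ▸ hj)
      · exact Or.inr ⟨⟨j, hji⟩, hj⟩)
    (fun j => tr 1 j.1) (fun j => coverElement 𝒜 (e₀.symm ∘ ![X 0, X 1, X 2]) ![3, 1, 2] (dv * (6 * p)) (y j.1) (hy j.1)) (fun j => htrE 1 j.1)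
    hΨv (fun j => htrU 1 j.1)
  -- ### MOVE 2: the kill by ONE graph member
  refine killsIn_one_of_disjointPrincipalFamily_datum hp hG φ M₁ 𝔄₁ (fun _ : Unit => J) hDpos (fun _ => hJ) ?_ id (fun _ => OW 1) (fun _ => hJW) ?_ hF₁W
  · intro i j hij; exact absurd (Subsingleton.elim i j) hij
  · intro c j hj; exact absurd (Subsingleton.elim j (id c)) hj

/-- ★★★ **R4a: the tangent-parabola class inhabits the research stub** — for every node atlas `𝔄₀` on the initial model the conclusion of `ReachLowerInF(X)`
holds at `(M₀, 𝔄₀)` (✓`exists_reachLowerF_of_killsIn_datum` on `tparab_killsIn_two`). [OURS · L1 W4.5c · R-F15n; NOT a statement of the manuscript] -/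
theorem exists_reachLowerF_initial_of_tparab [Finite G] (hp : p.Prime) (hG : ∀ g : G, g ∈ Subgroup.zpowers g₀) (hg₀ : g₀ ^ p = 1)
    (hq : ∀ g : G, (ρ g).hom ≫ q = q) [IsIntegral X'] [IsLocallyNoetherian X'] [X'.IsSeparated] [IsAffine X']
    (hreg : Scheme.IsRegular X') {k' : Type} [Field k'] (φ : X₁ ⟶ Spec (.of k')) [IsSeparated φ] [LocallyOfFiniteType φ] [IsFinite q]
    {k : Type} [Field k] [CharP k p] (hp2 : p ≠ 2) (σ : MvPolynomial (Fin 4) k ≃+* MvPolynomial (Fin 4) k) (hC : ∀ a : k, σ (C a) = C a)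
    (h0 : σ (X 0) = X 0) (h1 : σ (X 1) = X 1 + X 0) (h2 : σ (X 2) = X 2) (h3 : σ (X 3) = X 3 + (X 2 - X 1 ^ 2))
    (e : Γ(X', ⊤) ≃+* MvPolynomial (Fin 4) k)
    (hστ : ∀ t : Γ(X', ⊤), e ((ρ g₀⁻¹).hom.appLE ⊤ ⊤ (by rw [Scheme.Hom.preimage_top]) t) = σ (e t))
    (h₀ : NodeAtlas p (⟨ρ, hq⟩ : ActionOver q G) g₀) (𝔄₀ : NodeAtlasData p (GModel.initial hq h₀).act g₀) :
    ∃ P : ∀ M : GModel p q G ρ g₀, NodeAtlasData p M.act g₀ → Prop,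
      P (GModel.initial hq h₀) 𝔄₀ ∧ ∀ (M : GModel p q G ρ g₀) (𝔄 : NodeAtlasData p M.act g₀), P M 𝔄 → ¬ M.Terminal →
        ∃ n : ℕ, TreeF P (fun N 𝔅 => LexLTF N 𝔅 M 𝔄) n M 𝔄 :=
  exists_reachLowerF_of_killsIn_datum hp hG φ (GModel.initial hq h₀) 𝔄₀ (tparab_killsIn_two hp hG hg₀ hq hreg φ hp2 σ hC h0 h1 h2 h3 e hστ h₀)

/-- ★★★ **R4a in the CENSUS COORDINATES**: σ: `x₁ ↦ x₁ + x₀`, `x₂ ↦ x₂ + x₀`, `x₃ ↦ x₃ + (x₂ − x₁) − x₁²` (plan-1 R-F15n (2) verbatim) ⇒ `KillsIn 2 (GModel.initial hq h₀)`,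
by the LINEAR RECOORDINATION `u = x₂ − x₁` (✓`FreeModel.exists_linShear`, absorbed into `e`) and ✓`tparab_killsIn_two`. [OURS · L1 W4.5c · R-F15n R4a] -/
theorem tparabCensus_killsIn_two [Finite G] (hp : p.Prime) (hG : ∀ g : G, g ∈ Subgroup.zpowers g₀) (hg₀ : g₀ ^ p = 1)
    (hq : ∀ g : G, (ρ g).hom ≫ q = q) [IsIntegral X'] [IsLocallyNoetherian X'] [X'.IsSeparated] [IsAffine X']
    (hreg : Scheme.IsRegular X') {k' : Type} [Field k'] (φ : X₁ ⟶ Spec (.of k')) [IsSeparated φ] [LocallyOfFiniteType φ] [IsFinite q]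
    {k : Type} [Field k] [CharP k p] (hp2 : p ≠ 2) (σ : MvPolynomial (Fin 4) k ≃+* MvPolynomial (Fin 4) k) (hC : ∀ a : k, σ (C a) = C a)
    (h0 : σ (X 0) = X 0) (h1 : σ (X 1) = X 1 + X 0) (h2 : σ (X 2) = X 2 + X 0) (h3 : σ (X 3) = X 3 + ((X 2 - X 1) - X 1 ^ 2))
    (e : Γ(X', ⊤) ≃+* MvPolynomial (Fin 4) k)
    (hστ : ∀ t : Γ(X', ⊤), e ((ρ g₀⁻¹).hom.appLE ⊤ ⊤ (by rw [Scheme.Hom.preimage_top]) t) = σ (e t))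
    (h₀ : NodeAtlas p (⟨ρ, hq⟩ : ActionOver q G) g₀) :
    KillsIn 2 (GModel.initial (p := p) (g₀ := g₀) hq h₀) := by
  classical
  -- the linear recoordination `γ : x₂ ↦ x₁ + x₂` (old coordinates in terms of the new ones `(x₀, x₁, u = x₂ − x₁, x₃)`)
  obtain ⟨γ, hγ2, hγ, hγ2', hγ'⟩ := FreeModel.exists_linShear k (1 : Fin 4) 2 (by decide) (1 : k) 1 one_ne_zero
  have hγ0 : γ (X 0) = X 0 := hγ 0 (by decide)
  have hγ1 : γ (X 1) = X 1 := hγ 1 (by decide)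
  have hγ3 : γ (X 3) = X 3 := hγ 3 (by decide)
  have hγ2'' : γ (X 2) = X 1 + X 2 := by rw [hγ2, C_1, one_mul, one_mul]
  have hγs2 : γ.symm (X 2) = X 2 - X 1 := by rw [hγ2', inv_one, C_1, one_mul, one_mul]
  have hγs0 : γ.symm (X 0) = X 0 := hγ' 0 (by decide)
  have hγs1 : γ.symm (X 1) = X 1 := hγ' 1 (by decide)
  have hγs3 : γ.symm (X 3) = X 3 := hγ' 3 (by decide)
  -- the conjugate `σ′ = γ σ γ⁻¹` and the recoordinated `e′ = γ ∘ e`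
  let σ' : MvPolynomial (Fin 4) k ≃+* MvPolynomial (Fin 4) k := (γ.symm.toRingEquiv.trans σ).trans γ.toRingEquiv
  have hσ' : ∀ x, σ' x = γ (σ (γ.symm x)) := fun _ => rfl
  have hC' : ∀ a : k, σ' (C a) = C a := fun a => by
    rw [hσ', show γ.symm (C a) = C a from γ.symm.commutes a, hC, show γ (C a) = C a from γ.commutes a]
  have h0' : σ' (X 0) = X 0 := by rw [hσ', hγs0, h0, hγ0]
  have h1' : σ' (X 1) = X 1 + X 0 := by rw [hσ', hγs1, h1, map_add, hγ1, hγ0]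
  have h2' : σ' (X 2) = X 2 := by
    rw [hσ', hγs2, map_sub, h2, h1, map_sub, map_add, map_add, hγ2'', hγ1, hγ0]; ring
  have h3' : σ' (X 3) = X 3 + (X 2 - X 1 ^ 2) := by
    rw [hσ', hγs3, h3, map_add, map_sub, map_sub, map_pow, hγ3, hγ2'', hγ1]; ring
  let e' : Γ(X', ⊤) ≃+* MvPolynomial (Fin 4) k := e.trans γ.toRingEquiv
  have hστ' : ∀ t : Γ(X', ⊤), e' ((ρ g₀⁻¹).hom.appLE ⊤ ⊤ (by rw [Scheme.Hom.preimage_top]) t) = σ' (e' t) := fun t => by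
    change γ (e _) = γ (σ (γ.symm (γ (e t))))
    rw [hστ, γ.symm_apply_apply]
  exact tparab_killsIn_two hp hG hg₀ hq hreg φ hp2 σ' hC' h0' h1' h2' h3' e' hστ' h₀

/-- ★★★ **R4a (census coordinates): the tangent-parabola datum of R-F15n inhabits the research stub** (✓`exists_reachLowerF_of_killsIn_datum` on
`tparabCensus_killsIn_two`). [OURS · L1 W4.5c · R-F15n R4a; NOT a statement of the manuscript] -/
theorem exists_reachLowerF_initial_of_tparabCensus [Finite G] (hp : p.Prime) (hG : ∀ g : G, g ∈ Subgroup.zpowers g₀) (hg₀ : g₀ ^ p = 1)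
    (hq : ∀ g : G, (ρ g).hom ≫ q = q) [IsIntegral X'] [IsLocallyNoetherian X'] [X'.IsSeparated] [IsAffine X']
    (hreg : Scheme.IsRegular X') {k' : Type} [Field k'] (φ : X₁ ⟶ Spec (.of k')) [IsSeparated φ] [LocallyOfFiniteType φ] [IsFinite q]
    {k : Type} [Field k] [CharP k p] (hp2 : p ≠ 2) (σ : MvPolynomial (Fin 4) k ≃+* MvPolynomial (Fin 4) k) (hC : ∀ a : k, σ (C a) = C a)
    (h0 : σ (X 0) = X 0) (h1 : σ (X 1) = X 1 + X 0) (h2 : σ (X 2) = X 2 + X 0) (h3 : σ (X 3) = X 3 + ((X 2 - X 1) - X 1 ^ 2))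
    (e : Γ(X', ⊤) ≃+* MvPolynomial (Fin 4) k)
    (hστ : ∀ t : Γ(X', ⊤), e ((ρ g₀⁻¹).hom.appLE ⊤ ⊤ (by rw [Scheme.Hom.preimage_top]) t) = σ (e t))
    (h₀ : NodeAtlas p (⟨ρ, hq⟩ : ActionOver q G) g₀) (𝔄₀ : NodeAtlasData p (GModel.initial hq h₀).act g₀) :
    ∃ P : ∀ M : GModel p q G ρ g₀, NodeAtlasData p M.act g₀ → Prop,
      P (GModel.initial hq h₀) 𝔄₀ ∧ ∀ (M : GModel p q G ρ g₀) (𝔄 : NodeAtlasData p M.act g₀), P M 𝔄 → ¬ M.Terminal →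
        ∃ n : ℕ, TreeF P (fun N 𝔅 => LexLTF N 𝔅 M 𝔄) n M 𝔄 :=
  exists_reachLowerF_of_killsIn_datum hp hG φ (GModel.initial hq h₀) 𝔄₀ (tparabCensus_killsIn_two hp hG hg₀ hq hreg φ hp2 σ hC h0 h1 h2 h3 e hστ h₀)

end Summit.ResolutionOfSingularities.ResolutionOfSingularities.Theorems.WildQuotientResolution.S1.GameFrame.GModel

end
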